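import Literature.NumberTheory.GaloisRepresentations.SerreCartanNormalizerGL2Fp
import HarnessLib

/-!
# Route `ErratumRoadFive` (rung K2), crux `NonSurjCorner` (item stmt-BirchSwinnertonDyer-19065), line `Lines/hybrid.lean`, r23 slot 6‴ (K-disjointness):
# GROUP-THEORETIC PRELIMINARY — a subgroup normalised by `N(C_s)` and containing the split half-Cartan contains the whole split Cartan
# (cell `bsd-stepL`, seat `bsd-stepL-corner-p1` g18; `--supports stmt-BirchSwinnertonDyer-19065 --as helper`)

WHY THIS FILE. Step one of the proof plan for r23's slot 6‴ (memo CORNER-G18 §6): if `[ρ̄(Γ_ℚ) : ρ̄(Γ_K)] = 2` then `ρ̄(Γ_K)` is normal in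
`G = N(P (* 0; 0 *) P⁻¹)` and contains the inertia image `P (1 0; 0 *) P⁻¹` (`p` unramified in `K`); this lemma upgrades that to the whole split Cartan
`P (* 0; 0 *) P⁻¹ ≤ ρ̄(Γ_K)`: `diag(u, v) = diag(1, v) · w diag(1, u) w⁻¹` with `w = P (0 1; 1 0) P⁻¹ ∈ G`. (The Frobenius at the inert `p` then lies in
the split Cartan — `mem_splitCartan_of_mem_normalizer_halfSplitCartan` — hence in `ρ̄(Γ_K)`, the contradiction; that step is NOT here.)
* `AuxPrimeSupplyCorner.splitCartan_le_of_halfSplitCartan_le_of_conj_mem`;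
* `AuxPrimeSupplyCorner.mem_of_apply_mem_map_of_index_two` (the index-two pull-back: if K-disjointness fails, `Γ_K = ρ̄⁻¹(ρ̄(Γ_K))`);
* `AuxPrimeSupplyCorner.mem_splitCartan_of_commute_of_ne`, `AuxPrimeSupplyCorner.splitCartan_eq_of_halfSplitCartan_le` (the inertia frame and the Cartan
  frame define the SAME split Cartan).

HONEST FRAMING: FOUR THEOREMS (no definition, no named fact, no `sorry`); pure group theory in `GL₂(𝔽_p)`; nothing about any curve; 19065 NOT closed; T7.
References (locators only): [cite: Serre1972, §2.1 a), §2.2].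
-/

noncomputable section

set_option autoImplicit false
set_option linter.dupNamespace false -- `Summit.BirchSwinnertonDyer.BirchSwinnertonDyer` (summit = problem), tree-wide

open scoped Classical MatrixGroups
open Matrix
open Literature.NumberTheory.GaloisRepresentations Literature.NumberTheory.GaloisRepresentations.Serre1972

namespace Summit.BirchSwinnertonDyer.BirchSwinnertonDyer.Theorems.AuxPrimeSupplyCorner

/-- **A subgroup normalised by the split-Cartan normaliser and containing the split half-Cartan contains the split Cartan** (`p ≠ 2`):
`P diag(u,v) P⁻¹ = [P diag(1,v) P⁻¹] · [w (P diag(1,u) P⁻¹) w⁻¹]` with `w = P (0 1; 1 0) P⁻¹ ∈ N(P (* 0; 0 *) P⁻¹)`. [cite: Serre1972, §2.1 a), §2.2] -/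
theorem splitCartan_le_of_halfSplitCartan_le_of_conj_mem {p : ℕ} [Fact p.Prime] (hp2 : p ≠ 2) {P : GL (Fin 2) (ZMod p)}
    {H : Subgroup (GL (Fin 2) (ZMod p))}
    (hconj : ∀ g ∈ Subgroup.normalizer (splitCartan P : Set (GL (Fin 2) (ZMod p))), ∀ h ∈ H, g * h * g⁻¹ ∈ H)
    (hC : halfSplitCartan P ≤ H) : splitCartan P ≤ H := by
  intro d hd
  have hF : ∃ u : (ZMod p)ˣ, u ≠ 1 := exists_units_ne_one hp2
  have hDg := (mem_splitCartan_iff (P := P) (g := d)).mp hd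
  set D : GL (Fin 2) (ZMod p) := P⁻¹ * d * P with hD
  clear_value D
  obtain ⟨hD01, hD10⟩ := hDg
  have hdet : (D : Matrix (Fin 2) (Fin 2) (ZMod p)).det ≠ 0 := GL2.det_ne_zero D
  rw [GL2.det_of_isDg ⟨hD01, hD10⟩] at hdet
  have hu : (D : Matrix (Fin 2) (Fin 2) (ZMod p)) 0 0 ≠ 0 := left_ne_zero_of_mul hdet
  have hv : (D : Matrix (Fin 2) (Fin 2) (ZMod p)) 1 1 ≠ 0 := right_ne_zero_of_mul hdet
  -- the three test elements (in the frame `P`)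
  obtain ⟨Y₁, hY₁⟩ : ∃ Y : GL (Fin 2) (ZMod p), (Y : Matrix (Fin 2) (Fin 2) (ZMod p)) =
      !![1, 0; 0, (D : Matrix (Fin 2) (Fin 2) (ZMod p)) 1 1] :=
    ⟨Matrix.GeneralLinearGroup.mkOfDetNeZero _ (by rw [Matrix.det_fin_two_of]; simpa using hv), rfl⟩
  obtain ⟨Y₂, hY₂⟩ : ∃ Y : GL (Fin 2) (ZMod p), (Y : Matrix (Fin 2) (Fin 2) (ZMod p)) =
      !![1, 0; 0, (D : Matrix (Fin 2) (Fin 2) (ZMod p)) 0 0] :=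
    ⟨Matrix.GeneralLinearGroup.mkOfDetNeZero _ (by rw [Matrix.det_fin_two_of]; simpa using hu), rfl⟩
  obtain ⟨A, hA⟩ : ∃ Y : GL (Fin 2) (ZMod p), (Y : Matrix (Fin 2) (Fin 2) (ZMod p)) = !![0, (1 : ZMod p); 1, 0] :=
    ⟨Matrix.GeneralLinearGroup.mkOfDetNeZero _ (by rw [Matrix.det_fin_two_of]; norm_num), rfl⟩
  have hAA : A * A = 1 := by
    apply Units.ext
    rw [Units.val_mul, hA, Units.val_one, Matrix.mul_fin_two, Matrix.one_fin_two]
    norm_num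
  have hAinv : A⁻¹ = A := inv_eq_of_mul_eq_one_right hAA
  -- memberships
  have h1 : P * Y₁ * P⁻¹ ∈ H := hC ((mem_halfSplitCartan_iff (P := P)).mpr (by
    rw [show P⁻¹ * (P * Y₁ * P⁻¹) * P = Y₁ by group]
    exact ⟨⟨by simp [hY₁], by simp [hY₁]⟩, by simp [hY₁]⟩))
  have h2 : P * Y₂ * P⁻¹ ∈ H := hC ((mem_halfSplitCartan_iff (P := P)).mpr (by
    rw [show P⁻¹ * (P * Y₂ * P⁻¹) * P = Y₂ by group]
    exact ⟨⟨by simp [hY₂], by simp [hY₂]⟩, by simp [hY₂]⟩))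
  have hw : P * A * P⁻¹ ∈ Subgroup.normalizer (splitCartan P : Set (GL (Fin 2) (ZMod p))) := by
    rw [mem_normalizer_splitCartan_iff hF, show P⁻¹ * (P * A * P⁻¹) * P = A by group]
    exact Or.inr ⟨by simp [hA], by simp [hA]⟩
  have h3 : (P * A * P⁻¹) * (P * Y₂ * P⁻¹) * (P * A * P⁻¹)⁻¹ ∈ H := hconj _ hw _ h2
  have hprod : (P * Y₁ * P⁻¹) * ((P * A * P⁻¹) * (P * Y₂ * P⁻¹) * (P * A * P⁻¹)⁻¹) ∈ H := H.mul_mem h1 h3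
  -- the identity `d = [P Y₁ P⁻¹] · [w (P Y₂ P⁻¹) w⁻¹]`
  have hYD : Y₁ * (A * Y₂ * A) = D := by
    apply Units.ext
    rw [Units.val_mul, Units.val_mul, Units.val_mul, hY₁, hY₂, hA, Matrix.mul_fin_two, Matrix.mul_fin_two, Matrix.mul_fin_two]
    rw [Matrix.eta_fin_two (D : Matrix (Fin 2) (Fin 2) (ZMod p)), hD01, hD10]
    congr 1; simp
  have hd' : d = (P * Y₁ * P⁻¹) * ((P * A * P⁻¹) * (P * Y₂ * P⁻¹) * (P * A * P⁻¹)⁻¹) := by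
    have : d = P * D * P⁻¹ := by rw [hD]; group
    rw [this, ← hYD]
    have hwinv : (P * A * P⁻¹)⁻¹ = P * A * P⁻¹ := by
      rw [_root_.mul_inv_rev, _root_.mul_inv_rev, inv_inv, hAinv, mul_assoc]
    rw [hwinv]
    group
  rw [hd']
  exact hprod


/-! ### The index-two dichotomy for the image of `res Γ_K` -/

/-- **Index-two pull-back.** `f : Γ → M` a homomorphism, `H ≤ Γ` of index `2`. If some value `f σ` is NOT taken on `H`, then `H` is the FULL preimage
of `f(H)`: every `γ` with `f γ ∈ f(H)` lies in `H`. (Used with `H = res Γ_K`, `f = ρ̄_{E,p}`: if K-disjointness fails, an arithmetic Frobenius whose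
image lies in `ρ̄(Γ_K)` lies in `Γ_K` — impossible at an inert prime.) [folklore] -/
theorem mem_of_apply_mem_map_of_index_two {Γ M : Type*} [Group Γ] [Group M] (f : Γ →* M) {H : Subgroup Γ}
    (hH : H.index = 2) {σ : Γ} (hσ : ∀ τ ∈ H, f τ ≠ f σ) {γ : Γ} (hγ : f γ ∈ H.map f) : γ ∈ H := by
  set C : Subgroup Γ := (H.map f).comap f with hC
  have hHC : H ≤ C := fun x hx ↦ Subgroup.mem_comap.mpr (Subgroup.mem_map_of_mem f hx)
  have hσC : σ ∉ C := by
    intro h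
    obtain ⟨τ, hτ, hτσ⟩ := Subgroup.mem_map.mp (Subgroup.mem_comap.mp h)
    exact hσ τ hτ hτσ
  have hCtop : C ≠ ⊤ := fun h ↦ hσC (h ▸ Subgroup.mem_top σ)
  have hCidx : C.index = 2 := by
    have hdvd : C.index ∣ 2 := hH ▸ Subgroup.index_dvd_of_le hHC
    have hne : C.index ≠ 1 := fun h1 ↦ hCtop (Subgroup.index_eq_one.mp h1)
    have hle : C.index ≤ 2 := Nat.le_of_dvd two_pos hdvd
    interval_cases h : C.index
    · -- index 0 does not divide 2 nontrivially: `0 ∣ 2` is false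
      exact absurd hdvd (by decide)
    · exact absurd rfl hne
    · rfl
  have hrel : H.relIndex C = 1 := by
    have := Subgroup.relIndex_mul_index hHC
    rw [hCidx, hH] at this
    omega
  have hCH : C ≤ H := Subgroup.relIndex_eq_one.mp hrel
  exact hCH (Subgroup.mem_comap.mpr hγ)


/-! ### Two split Cartan subgroups sharing a split half-Cartan coincide -/

/-- **Commuting with a regular diagonal element forces diagonal form**: if `P⁻¹ t P` is diagonal with distinct diagonal entries and `g t = t g`, then
`g ∈ P (* 0; 0 *) P⁻¹`. [folklore] -/
theorem mem_splitCartan_of_commute_of_ne {p : ℕ} [Fact p.Prime] {P t g : GL (Fin 2) (ZMod p)}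
    (ht : GL2.IsDg ((P⁻¹ * t * P : GL (Fin 2) (ZMod p)) : Matrix (Fin 2) (Fin 2) (ZMod p)))
    (hne : ((P⁻¹ * t * P : GL (Fin 2) (ZMod p)) : Matrix (Fin 2) (Fin 2) (ZMod p)) 0 0 ≠
      ((P⁻¹ * t * P : GL (Fin 2) (ZMod p)) : Matrix (Fin 2) (Fin 2) (ZMod p)) 1 1)
    (hcomm : g * t = t * g) : g ∈ splitCartan P := by
  rw [mem_splitCartan_iff]
  set T : GL (Fin 2) (ZMod p) := P⁻¹ * t * P with hT
  set X : GL (Fin 2) (ZMod p) := P⁻¹ * g * P with hX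
  have hXT : X * T = T * X := by rw [hX, hT]; have := hcomm; calc
      P⁻¹ * g * P * (P⁻¹ * t * P) = P⁻¹ * (g * t) * P := by group
      _ = P⁻¹ * (t * g) * P := by rw [this]
      _ = P⁻¹ * t * P * (P⁻¹ * g * P) := by group
  clear_value T X
  obtain ⟨hT01, hT10⟩ := ht
  have hM : (X : Matrix (Fin 2) (Fin 2) (ZMod p)) * (T : Matrix (Fin 2) (Fin 2) (ZMod p)) =
      (T : Matrix (Fin 2) (Fin 2) (ZMod p)) * (X : Matrix (Fin 2) (Fin 2) (ZMod p)) := by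
    rw [← Units.val_mul, ← Units.val_mul, hXT]
  have h01 := congrFun (congrFun hM 0) 1
  have h10 := congrFun (congrFun hM 1) 0
  simp only [Matrix.mul_apply, Fin.sum_univ_two, hT01, hT10, mul_zero, zero_mul, add_zero, zero_add] at h01 h10
  -- `h01 : X 0 1 * T 1 1 = T 0 0 * X 0 1`, `h10 : X 1 0 * T 0 0 = T 1 1 * X 1 0`
  have hsub : (T : Matrix (Fin 2) (Fin 2) (ZMod p)) 0 0 - (T : Matrix (Fin 2) (Fin 2) (ZMod p)) 1 1 ≠ 0 := sub_ne_zero.mpr hne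
  constructor
  · have : (X : Matrix (Fin 2) (Fin 2) (ZMod p)) 0 1 * ((T : Matrix (Fin 2) (Fin 2) (ZMod p)) 0 0 - (T : Matrix (Fin 2) (Fin 2) (ZMod p)) 1 1) = 0 := by
      linear_combination -h01
    exact (mul_eq_zero.mp this).resolve_right hsub
  · have : (X : Matrix (Fin 2) (Fin 2) (ZMod p)) 1 0 * ((T : Matrix (Fin 2) (Fin 2) (ZMod p)) 0 0 - (T : Matrix (Fin 2) (Fin 2) (ZMod p)) 1 1) = 0 := by
      linear_combination h10
    exact (mul_eq_zero.mp this).resolve_right hsub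

/-- **Two split Cartan subgroups sharing a split half-Cartan subgroup coincide** (`p ≠ 2`): if `P₁ (1 0; 0 *) P₁⁻¹ ≤ P (* 0; 0 *) P⁻¹` then
`P₁ (* 0; 0 *) P₁⁻¹ = P (* 0; 0 *) P⁻¹` — both are the centraliser of the regular element `P₁ diag(1, a) P₁⁻¹`, `a ≠ 1`. (In the (K) plan: the inertia
frame `P₁` and lane B's Cartan frame `P` define the same split Cartan, hence the same normaliser.) [cite: Serre1972, §2.1 a)] -/
theorem splitCartan_eq_of_halfSplitCartan_le {p : ℕ} [Fact p.Prime] (hp2 : p ≠ 2) {P P₁ : GL (Fin 2) (ZMod p)}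
    (h : halfSplitCartan P₁ ≤ splitCartan P) : splitCartan P₁ = splitCartan P := by
  obtain ⟨a, ha⟩ : ∃ u : (ZMod p)ˣ, u ≠ 1 := exists_units_ne_one hp2
  -- the regular element `t = P₁ diag(1, a) P₁⁻¹`
  obtain ⟨Y, hY⟩ : ∃ Y : GL (Fin 2) (ZMod p), (Y : Matrix (Fin 2) (Fin 2) (ZMod p)) = !![1, 0; 0, (a : ZMod p)] :=
    ⟨Matrix.GeneralLinearGroup.mkOfDetNeZero _ (by rw [Matrix.det_fin_two_of]; simp), rfl⟩
  set t : GL (Fin 2) (ZMod p) := P₁ * Y * P₁⁻¹ with ht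
  have hY1 : P₁⁻¹ * t * P₁ = Y := by rw [ht]; group
  have htH : t ∈ halfSplitCartan P₁ := (mem_halfSplitCartan_iff (P := P₁)).mpr (by
    rw [hY1]; exact ⟨⟨by simp [hY], by simp [hY]⟩, by simp [hY]⟩)
  have ha1 : (1 : ZMod p) ≠ (a : ZMod p) := fun h1 ↦ ha (Units.ext h1.symm)
  -- in frame `P₁`: `t` is diagonal with entries `1 ≠ a`
  have htDg₁ : GL2.IsDg ((P₁⁻¹ * t * P₁ : GL (Fin 2) (ZMod p)) : Matrix (Fin 2) (Fin 2) (ZMod p)) := by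
    rw [hY1]; exact ⟨by simp [hY], by simp [hY]⟩
  have htne₁ : ((P₁⁻¹ * t * P₁ : GL (Fin 2) (ZMod p)) : Matrix (Fin 2) (Fin 2) (ZMod p)) 0 0 ≠
      ((P₁⁻¹ * t * P₁ : GL (Fin 2) (ZMod p)) : Matrix (Fin 2) (Fin 2) (ZMod p)) 1 1 := by
    rw [hY1, hY]; intro h'; apply ha1; simpa using h'
  -- in frame `P`: `t ∈ splitCartan P` is diagonal; its entries are distinct because `t` has the two eigen-relations … we argue via trace and determinant:
  -- `P⁻¹ t P` and `P₁⁻¹ t P₁` are conjugate diagonal matrices, so `{d₀ d₁} = {1, a}`; if `d₀ = d₁` then `t` would be scalar, but `Y` is not.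
  have htC : t ∈ splitCartan P := h htH
  have htDg : GL2.IsDg ((P⁻¹ * t * P : GL (Fin 2) (ZMod p)) : Matrix (Fin 2) (Fin 2) (ZMod p)) := (mem_splitCartan_iff (P := P)).mp htC
  have htne : ((P⁻¹ * t * P : GL (Fin 2) (ZMod p)) : Matrix (Fin 2) (Fin 2) (ZMod p)) 0 0 ≠
      ((P⁻¹ * t * P : GL (Fin 2) (ZMod p)) : Matrix (Fin 2) (Fin 2) (ZMod p)) 1 1 := by
    intro heq
    -- then `P⁻¹ t P` is scalar `c • 1`, hence `t = c • 1`, hence `Y = P₁⁻¹ t P₁ = c • 1`: contradiction with `Y 0 0 = 1 ≠ a = Y 1 1`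
    set D : GL (Fin 2) (ZMod p) := P⁻¹ * t * P with hD
    obtain ⟨c, hc⟩ : ∃ c : ZMod p, (D : Matrix (Fin 2) (Fin 2) (ZMod p)) = c • (1 : Matrix (Fin 2) (Fin 2) (ZMod p)) := by
      refine ⟨(D : Matrix (Fin 2) (Fin 2) (ZMod p)) 0 0, ?_⟩
      rw [Matrix.smul_one_eq_diagonal]
      conv_lhs => rw [htDg.eq_diagonal]
      congr 1; ext i; fin_cases i
      · rfl
      · exact heq.symm
    clear_value D
    have htmat : (t : Matrix (Fin 2) (Fin 2) (ZMod p)) = c • (1 : Matrix (Fin 2) (Fin 2) (ZMod p)) := by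
      have : t = P * D * P⁻¹ := by rw [hD]; group
      rw [this, Units.val_mul, Units.val_mul, hc, Matrix.mul_smul, Matrix.mul_one, Matrix.smul_mul, ← Units.val_mul, mul_inv_cancel,
        Units.val_one]
    have hYmat : (Y : Matrix (Fin 2) (Fin 2) (ZMod p)) = c • (1 : Matrix (Fin 2) (Fin 2) (ZMod p)) := by
      rw [← hY1, Units.val_mul, Units.val_mul, htmat, Matrix.mul_smul, Matrix.mul_one, Matrix.smul_mul, ← Units.val_mul, inv_mul_cancel,
        Units.val_one]
    have h00 := congrFun (congrFun hYmat 0) 0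
    have h11 := congrFun (congrFun hYmat 1) 1
    rw [hY] at h00 h11
    simp at h00 h11
    exact ha1 (h00.trans h11.symm)
  -- both inclusions via the commutation lemma
  have hcommC : ∀ {Q : GL (Fin 2) (ZMod p)} {x y : GL (Fin 2) (ZMod p)}, x ∈ splitCartan Q → y ∈ splitCartan Q → x * y = y * x := by
    intro Q x y hx hy
    rw [mem_splitCartan_iff] at hx hy
    set X₁ : GL (Fin 2) (ZMod p) := Q⁻¹ * x * Q with hX₁
    set Y₁ : GL (Fin 2) (ZMod p) := Q⁻¹ * y * Q with hY₁'
    clear_value X₁ Y₁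
    have key : X₁ * Y₁ = Y₁ * X₁ := by
      apply Units.ext
      rw [Units.val_mul, Units.val_mul, hx.eq_diagonal, hy.eq_diagonal, Matrix.diagonal_mul_diagonal, Matrix.diagonal_mul_diagonal]
      congr 1; ext i; ring
    have hx' : x = Q * X₁ * Q⁻¹ := by rw [hX₁]; group
    have hy' : y = Q * Y₁ * Q⁻¹ := by rw [hY₁']; group
    rw [hx', hy']
    calc Q * X₁ * Q⁻¹ * (Q * Y₁ * Q⁻¹) = Q * (X₁ * Y₁) * Q⁻¹ := by group
      _ = Q * (Y₁ * X₁) * Q⁻¹ := by rw [key]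
      _ = Q * Y₁ * Q⁻¹ * (Q * X₁ * Q⁻¹) := by group
  apply le_antisymm
  · intro g hg
    exact mem_splitCartan_of_commute_of_ne htDg htne (hcommC hg ((halfSplitCartan_le_splitCartan P₁) htH))
  · intro g hg
    exact mem_splitCartan_of_commute_of_ne htDg₁ htne₁ (hcommC hg htC)

end Summit.BirchSwinnertonDyer.BirchSwinnertonDyer.Theorems.AuxPrimeSupplyCorner

end
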